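import Summits.Ventures.HodgeRepro.CMHodgeSpanOn
import Summits.Ventures.HodgeRepro.RouteCClauses

/-!
# The Weil line of a face on `B_red`, in the eigenspace form: a joint `(2,2)`-eigenvector of every Galois
conjugate of the cocharacter of `B_red`'s CM algebra

Blind re-derivation cell `pub-hodge-repro`, seat `night-1`.  Imports typer-2's `CMHodgeSpanOn.lean` (landed
p374483) and `RouteCClauses.lean` (for `corner_eq_of_cosetMap_eq` / `injOn_cosetMap_reducedSet_of_injective`,
section FaceRecords).

typer-2's dictionary (`CMHodgeOn.isHodgeSetOn_iff_forall_map_cocharOn_smul_eq`) turns Pohlmann's condition on a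
`G`-set `X` into the `(p, p)`-condition for every conjugate cocharacter: for an injective family `s` of `2p`
points of `X`, `IsHodgeSetOn c Ψ (image s)` iff `⋀^{2p} μ_{g • Ψ}(λ) e_S = λ^p e_S` for all `g ∈ G`, `λ ∈ ℂ`.
Applied to the coset `G`-set `cosetSet Φ` of `B_red = ∏_k Simple (Φ k)` and the image of a reduced set `U_s`
(`RouteCCosetModel.isHodgeSetOn_cosetMap_reducedSet`), this gives THE EIGENSPACE FORM of Lemma R's core:

* `weilEnum Φ cls tw s₀ : Fin 4 → cosetSet Φ` — the four points `⟨cls i, s₀ (tw i)⁻¹ · rstab⟩` of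
  `cosetMap(U_{s₀})`, injective for distinct corners (`weilEnum_injective`);
* `weilWedge Φ cls tw s₀ ∈ ⋀⁴ ℂ^{cosetSet Φ}` — their coordinate wedge, the `s₀`-line of the Weil class
  `W_F(B)` read on `B_red` (non-zero: `weilWedge_ne_zero`);
* **`weilWedge_mem_jointEigenspaceOn`** — it lies in `jointEigenspaceOn (fun g => g • cosetType Φ) 4 2`: for
  every Galois conjugate `g • Ψ` of the CM type `Ψ = cosetType Φ` of `B_red` and every `λ`, the cocharacter
  `⋀⁴ μ_{g•Ψ}(λ)` multiplies it by `λ²` — a `(2, 2)`-class of `B_red` and of all its Galois conjugates, i.e. a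
  Hodge class in the sense of Pohlmann / Deligne Ex. 3.7 (typer-2's (β) identification, ROUTE.md §3.5 / ROUTE-B
  §9.21), on the face's reduced product.

Nothing here says anything about the status of the Hodge conjecture for CM abelian varieties, which is NOT proved.
-/

open Finset
open scoped Pointwise

namespace HodgeRepro.RouteC

open CMHodgeOn

variable {G : Type*} [Group G] [DecidableEq G] [Fintype G] {J : Type*} [Fintype J] [DecidableEq J]

/-- The four points of `cosetMap(U_{s₀})`, enumerated by the corners. -/
def weilEnum (Φ : J → Finset G) (cls : Fin 4 → J) (tw : Fin 4 → G) (s₀ : G) : Fin 4 → cosetSet Φ :=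
  fun i => cosetMap Φ (cls i, s₀ * (tw i)⁻¹)

omit [Fintype G] [Fintype J] in
/-- The image of `weilEnum` is the image of the reduced set. -/
theorem image_weilEnum (Φ : J → Finset G) (cls : Fin 4 → J) (tw : Fin 4 → G) (s₀ : G) :
    univ.image (weilEnum Φ cls tw s₀) = (reducedSet cls tw s₀).image (cosetMap Φ) := by
  ext x
  simp only [weilEnum, Finset.mem_image, Finset.mem_univ, true_and, mem_reducedSet]
  constructor
  · rintro ⟨i, rfl⟩
    exact ⟨(cls i, s₀ * (tw i)⁻¹), ⟨i, rfl⟩, rfl⟩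
  · rintro ⟨q, ⟨i, rfl⟩, rfl⟩
    exact ⟨i, rfl⟩

omit [DecidableEq G] [Fintype G] [Fintype J] [DecidableEq J] in
/-- For a face with four distinct corners, `weilEnum` is injective. -/
theorem weilEnum_injective (Φ : J → Finset G) (cls : Fin 4 → J) (tw : Fin 4 → G)
    (hinj : Function.Injective (corner Φ cls tw)) (s₀ : G) :
    Function.Injective (weilEnum Φ cls tw s₀) := by
  intro i i' h
  exact hinj (corner_eq_of_cosetMap_eq Φ cls tw s₀ h)

/-- The `s₀`-line of the Weil class of the face on `B_red`: the coordinate wedge of `cosetMap(U_{s₀})` in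
`⋀⁴ ℂ^{cosetSet Φ}`. -/
noncomputable def weilWedge (Φ : J → Finset G) (cls : Fin 4 → J) (tw : Fin 4 → G) (s₀ : G) :
    ⋀[ℂ]^(2 * 2) (cosetSet Φ → ℂ) :=
  coordWedgeOn (2 * 2) (weilEnum Φ cls tw s₀)

omit [Fintype G] [Fintype J] in
/-- The Weil line is non-zero. -/
theorem weilWedge_ne_zero (Φ : J → Finset G) (cls : Fin 4 → J) (tw : Fin 4 → G)
    (hinj : Function.Injective (corner Φ cls tw)) (s₀ : G) : weilWedge Φ cls tw s₀ ≠ 0 :=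
  coordWedgeOn_ne_zero (weilEnum_injective Φ cls tw hinj s₀)

/-- **The eigenspace form of Lemma R's core**: for a `SumTwo` face with distinct corners and distinct
`(cls, tw)`, the Weil line `weilWedge Φ cls tw s₀` is a joint `λ²`-eigenvector of `⋀⁴ μ_{g • cosetType Φ}(λ)`
for every `g ∈ G` and `λ ∈ ℂ` — a `(2,2)`-class of `B_red` and of every Galois conjugate. -/
theorem weilWedge_mem_jointEigenspaceOn {c : G} (hc : IsComplexConj c) (Φ : J → Finset G)
    (hΦ : ∀ k, IsCMType c (Φ k)) (cls : Fin 4 → J) (tw : Fin 4 → G)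
    (hinj : Function.Injective fun i => (cls i, tw i)) (hcinj : Function.Injective (corner Φ cls tw))
    (hsum : SumTwo (corner Φ cls tw)) (s₀ : G) :
    weilWedge Φ cls tw s₀ ∈ jointEigenspaceOn (fun g : G => g • cosetType Φ) (2 * 2) 2 := by
  rw [mem_jointEigenspaceOn_iff]
  have hinjE := weilEnum_injective Φ cls tw hcinj s₀
  have hH : IsHodgeSetOn c (cosetType Φ) (univ.image (weilEnum Φ cls tw s₀)) := by
    rw [image_weilEnum]
    exact isHodgeSetOn_cosetMap_reducedSet hc Φ cls tw hinj hsum s₀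
      (injOn_cosetMap_reducedSet_of_injective Φ cls tw hcinj s₀)
  exact (isHodgeSetOn_iff_forall_map_cocharOn_smul_eq hc (isCMTypeOn_cosetType hΦ) hinjE).1 hH

end HodgeRepro.RouteC
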